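import Summits.BirchSwinnertonDyer.BirchSwinnertonDyer.Theorems.SchneiderFreeAdditiveX3PoitouTateLocalDualityEveryPlace
import HarnessLib

/-!
# Poitou–Tate toolkit (2/3): Howard's Thm. 2.1.11 for a pair of Selmer structures `𝓕 ≤ 𝓖` FROM Milne's
# basic middle exactness `Ker γ¹ ⊆ Im β¹`

Seat `bsd-schneider-door-c6`, gen 5 (cell `bsd-schneider-ideate`; crux `AnticycControlAdditiveK`,
stmt-BirchSwinnertonDyer-19295).  THEOREMS ONLY (no definition, no named fact, no `sorry`).  HONEST
FRAMING: proves NO case of Poitou–Tate duality and no case of BSD; it reduces the conjunct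
`SelmerComplement` (Howard, Compositio 140 (2004) Thm. 2.1.11, both inclusions "annihilator ⊆ image",
all pairs `𝓕 ≤ 𝓖` unramified outside a finite `S`) of the named fact `poitouTate_selmerStructure_duality`
to the BASIC statement of Milne, *ADT* I Thm. 4.10(b), `r = 1`: for `S ⊇ {v ∣ ∞} ∪ {v ∣ n} ∪ Ram(M)`
finite and `t ∈ ⊕_{v∈S} H¹(K_v, M)` with `∑_{v∈S} inv_v(t_v ∪ y_v) = 0` for every `y ∈ H¹(K, M^D)`
unramified outside `S` (`= H¹(G_S, M^D)`), there is `x ∈ H¹(K, M)` unramified outside `S` with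
`loc_v x = t_v` (`v ∈ S`) — hypothesis `hE`; and the same for `M^D` with `M` on the left of the pairing
— hypothesis `hE'`.

* `exists_selmer_sub_mem_of_middleExact` — inclusion (i) of Howard's theorem for `𝓕 ≤ 𝓖` from `hE`;
* `exists_dualSelmer_sub_mem_of_middleExact` — inclusion (ii) from `hE'`.

For a family `inv` that is a local Tate duality at the finite places (`IsPerfect`), injective at the
real places (`InjectiveAtRealPlaces`) and satisfies Milne I Thm. 2.6 (`UnramifiedOrthogonal`).
MECHANISM (file 1/3 `…PoitouTateLocalDualityEveryPlace.lean`): in the perfect pairing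
`⊕_{v∈S} H¹(K_v, M) × ⊕_{v∈S} H¹(K_v, M^D) → ℤ/n` the localisation of `H¹_{𝓕^*}(K, M^D)` is
`loc(H¹_S(M^D)) ⊓ ⊕_v 𝓕_v^*` (Milne I 2.6 off `S`), whose left annihilator is
`{}^⊥loc(H¹_S(M^D)) ⊔ {}^⊥(⊕_v 𝓕_v^*) = {}^⊥loc(H¹_S(M^D)) ⊔ ⊕_v 𝓕_v` (annihilator of a meet, double
annihilator) `⊆ loc(H¹_S(M)) + ⊕_v 𝓕_v` by `hE`; symmetrically for (ii).  The assembly into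
`SelmerComplement` and the packaging for THE invariant maps `LocalInvariants.canonical` are file 3/3.

References: [Howard2004HeegnerKolyvagin] Def. 2.1.6, 2.1.10, Thm. 2.1.11 (arXiv:1202.6340 pp. 5–6);
[MilneADT2006] I Prop. 0.19, Cor. 2.3, Thm. 2.6, Thm. 2.13 (a), Thm. 4.10 (b); [Rubin2000] Thm. 1.7.3.
-/

noncomputable section

open Function NumberField IsDedekindDomain
open scoped NumberField

universe u

set_option linter.dupNamespace false

namespace Summit.BirchSwinnertonDyer.BirchSwinnertonDyer.Theorems.SchneiderFreeAdditiveX3.PoitouTateReduction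

open Summit.BirchSwinnertonDyer.Rank1Residual.X11b.FiniteDuality

/-! ## §3. The reduction: Howard's Thm. 2.1.11 for `𝓕 ≤ 𝓖` from the basic middle exactness -/

section Reduction

open Field
open Literature.NumberTheory.GaloisRepresentations Literature.NumberTheory.GaloisCohomology
open Literature.NumberTheory.GaloisRepresentations.DiscreteGaloisModule (mu localTatePairingZMod
  tateDual SelmerStructure unramifiedSubgroup)

variable {K : Type u} [Field K] [NumberField K] {n : ℕ} [NeZero n]
variable {M : Type u} [AddCommGroup M] [TopologicalSpace M] [DiscreteTopology M] [Finite M]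

/-- **Howard Thm. 2.1.11, first exact sequence, inclusion `⊇` ("annihilator ⊆ image") for a pair of
Selmer structures `𝓕 ≤ 𝓖` unramified outside `S`, FROM the basic middle exactness `Ker γ¹ ⊆ Im β¹`
of Milne I Thm. 4.10(b) for `(M, S)`** (hypothesis `hE`: a family `(t_v)_{v ∈ S}` of local classes with
`∑_{v∈S} ⟨t_v, y_v⟩_v = 0` for every global `y ∈ H¹(K, M^D)` unramified outside `S` is the localisation
of a global `x ∈ H¹(K, M)` unramified outside `S`).  Mechanism: in the perfect pairing
`⊕_{v∈S} H¹(K_v, M) × ⊕_{v∈S} H¹(K_v, M^D) → ℤ/n` (local Tate duality at every place of `S`), the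
localisation of `H¹_{𝓕^*}(K, M^D)` is `loc(H¹_S(K, M^D)) ⊓ ⊕_v 𝓕_v^*` (Milne I Thm. 2.6 off `S`), whose
left annihilator is `{}^⊥loc(H¹_S(K, M^D)) ⊔ ⊕_v 𝓕_v ⊆ loc(H¹_S(K, M)) + ⊕_v 𝓕_v` (annihilator of a
meet; double annihilator; `hE`).
[cite: Howard2004HeegnerKolyvagin, Thm. 2.1.11 (arXiv:1202.6340 p. 6)] [cite: MilneADT2006, Ch. I, Thm. 4.10(b)] -/
theorem exists_selmer_sub_mem_of_middleExact (inv : LocalInvariants K n) (hperf : inv.IsPerfect)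
    (hreal : inv.InjectiveAtRealPlaces) (hUO : inv.UnramifiedOrthogonal)
    (ρ : DiscreteGaloisModule K M) (hM : ∀ m : M, n • m = 0) {S : Finset (Place K)}
    (hS : ∀ v : HeightOneSpectrum (𝓞 K), (Sum.inr v : Place K) ∉ S →
      ((n : ℕ) : 𝓞 K) ∉ v.asIdeal ∧ GaloisRep.IsUnramifiedAt v ρ)
    (hE : ∀ t : Π v : Place K, galoisCohomology (ρ.toLocal v) 1,
      (∀ y : galoisCohomology (ρ.tateDual n) 1,
        (∀ v : HeightOneSpectrum (𝓞 K), (Sum.inr v : Place K) ∉ S →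
          galoisCohomology.localization (ρ.tateDual n) (Sum.inr v) 1 y ∈
            unramifiedSubgroup (GaloisRep.toLocal v (ρ.tateDual n)) 1) →
        ∑ v ∈ S, localTatePairingZMod ρ n v (inv v) (t v)
          (galoisCohomology.localization (ρ.tateDual n) v 1 y) = 0) →
      ∃ x : galoisCohomology ρ 1,
        (∀ v : HeightOneSpectrum (𝓞 K), (Sum.inr v : Place K) ∉ S →
          galoisCohomology.localization ρ (Sum.inr v) 1 x ∈
            unramifiedSubgroup (GaloisRep.toLocal v ρ) 1) ∧
        ∀ v ∈ S, galoisCohomology.localization ρ v 1 x = t v)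
    {𝓕 𝓖 : SelmerStructure ρ} (hle : 𝓕 ≤ 𝓖) (h𝓕 : 𝓕.IsUnramifiedOutside S)
    (h𝓖 : 𝓖.IsUnramifiedOutside S)
    (t : Π v : Place K, galoisCohomology (ρ.toLocal v) 1) (ht : ∀ v ∈ S, t v ∈ 𝓖 v)
    (horth : ∀ y ∈ (inv.dualSelmerStructure ρ 𝓕).selmerGroup,
      ∑ v ∈ S, localTatePairingZMod ρ n v (inv v) (t v)
        (galoisCohomology.localization (ρ.tateDual n) v 1 y) = 0) :
    ∃ x ∈ 𝓖.selmerGroup, ∀ v ∈ S, galoisCohomology.localization ρ v 1 x - t v ∈ 𝓕 v := by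
  classical
  -- finiteness and `n`-torsion of the local groups over `S`
  haveI : ∀ i : ↥S, Finite (galoisCohomology (ρ.toLocal (i : Place K)) 1) := fun i =>
    finite_galoisCohomology_one_toLocal_place ρ i
  haveI : ∀ i : ↥S, Finite (galoisCohomology ((ρ.tateDual n).toLocal (i : Place K)) 1) := fun i =>
    finite_galoisCohomology_one_tateDual_toLocal_place ρ i
  have hAn : ∀ p : Π i : ↥S, galoisCohomology (ρ.toLocal (i : Place K)) 1, n • p = 0 :=
    pi_nsmul_eq_zero fun i x => galoisCohomology.nsmul_eq_zero_of_forall _ hM x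
  have hBn : ∀ q : Π i : ↥S, galoisCohomology ((ρ.tateDual n).toLocal (i : Place K)) 1, n • q = 0 :=
    pi_nsmul_eq_zero fun i y => galoisCohomology.nsmul_eq_zero_of_forall _
      (fun f => DiscreteGaloisModule.TateDual.nsmul_eq_zero f) y
  -- the sum pairing over `S` and its perfectness
  obtain ⟨b, hb⟩ := exists_piPairing
    (fun i : ↥S => localTatePairingZMod ρ n (i : Place K) (inv (i : Place K)))
  have hloc := fun i : ↥S => bijective_localTatePairingZMod_place inv hperf hreal ρ hM (i : Place K)
  obtain ⟨hbij, hbijflip⟩ := AddMonoidHom.bijective_of_injective_of_injective_flip hAn hBn b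
    (piPairing_injective hb fun i => (hloc i).1.1) (piPairing_flip_injective hb fun i => (hloc i).2.1)
  -- localisation to `S`
  let locS : galoisCohomology ρ 1 →+ Π i : ↥S, galoisCohomology (ρ.toLocal (i : Place K)) 1 :=
    AddMonoidHom.pi fun i : ↥S => galoisCohomology.localization ρ (i : Place K) 1
  let locSD : galoisCohomology (ρ.tateDual n) 1 →+
      Π i : ↥S, galoisCohomology ((ρ.tateDual n).toLocal (i : Place K)) 1 :=
    AddMonoidHom.pi fun i : ↥S => galoisCohomology.localization (ρ.tateDual n) (i : Place K) 1
  -- classes unramified outside `S`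
  let HS : AddSubgroup (galoisCohomology ρ 1) :=
    ⨅ (v : HeightOneSpectrum (𝓞 K)) (_ : (Sum.inr v : Place K) ∉ S),
      (unramifiedSubgroup (GaloisRep.toLocal v ρ) 1).comap
        (galoisCohomology.localization ρ (Sum.inr v) 1)
  let HSD : AddSubgroup (galoisCohomology (ρ.tateDual n) 1) :=
    ⨅ (v : HeightOneSpectrum (𝓞 K)) (_ : (Sum.inr v : Place K) ∉ S),
      (unramifiedSubgroup (GaloisRep.toLocal v (ρ.tateDual n)) 1).comap
        (galoisCohomology.localization (ρ.tateDual n) (Sum.inr v) 1)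
  have memHS : ∀ x, x ∈ HS ↔ ∀ v : HeightOneSpectrum (𝓞 K), (Sum.inr v : Place K) ∉ S →
      galoisCohomology.localization ρ (Sum.inr v) 1 x ∈ unramifiedSubgroup (GaloisRep.toLocal v ρ) 1 :=
    fun x => by simp only [HS, AddSubgroup.mem_iInf, AddSubgroup.mem_comap]; exact Iff.rfl
  have memHSD : ∀ y, y ∈ HSD ↔ ∀ v : HeightOneSpectrum (𝓞 K), (Sum.inr v : Place K) ∉ S →
      galoisCohomology.localization (ρ.tateDual n) (Sum.inr v) 1 y ∈
        unramifiedSubgroup (GaloisRep.toLocal v (ρ.tateDual n)) 1 :=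
    fun y => by simp only [HSD, AddSubgroup.mem_iInf, AddSubgroup.mem_comap]; exact Iff.rfl
  -- the local conditions on `S`
  let T : AddSubgroup (Π i : ↥S, galoisCohomology (ρ.toLocal (i : Place K)) 1) :=
    AddSubgroup.pi Set.univ fun i => 𝓕 (i : Place K)
  let T' : AddSubgroup (Π i : ↥S, galoisCohomology ((ρ.tateDual n).toLocal (i : Place K)) 1) :=
    AddSubgroup.pi Set.univ fun i => inv.dualSelmerStructure ρ 𝓕 (i : Place K)
  have hTT' : annRight b T = T' := by
    rw [annRight_pi hb]
    rfl
  have hT'T : annLeft b T' = T := by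
    rw [← hTT', annLeft_annRight hAn hBn b hbij hbijflip]
  -- (D) the basic exactness: `{}^⊥ loc(H¹_S(M^D)) ≤ loc(H¹_S(M))`
  have hD : annLeft b (HSD.map locSD) ≤ HS.map locS := by
    intro p hp
    let t₀ : Π v : Place K, galoisCohomology (ρ.toLocal v) 1 := fun v =>
      if h : v ∈ S then p ⟨v, h⟩ else 0
    have ht₀ : ∀ i : ↥S, t₀ i = p i := fun i => by
      simp only [t₀, dif_pos i.2]
    obtain ⟨x, hxur, hxS⟩ := hE t₀ fun y hy => by
      have hq : locSD y ∈ HSD.map locSD := AddSubgroup.mem_map_of_mem _ ((memHSD y).2 hy)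
      have h0 := hp _ hq
      rw [hb] at h0
      rw [← Finset.sum_coe_sort]
      refine Eq.trans (Finset.sum_congr rfl fun i _ => ?_) h0
      rw [ht₀ i]
      rfl
    refine ⟨x, (memHS x).2 hxur, funext fun i => ?_⟩
    rw [AddMonoidHom.pi_apply, hxS i i.2, ht₀ i]
  -- `t|_S` annihilates `loc(H¹_S(M^D)) ⊓ ⊕ 𝓕_v^*`, the localisation of `H¹_{𝓕^*}`
  have htS : (fun i : ↥S => t i) ∈ annLeft b (HSD.map locSD ⊓ T') := by
    rw [mem_annLeft_iff]
    rintro q ⟨hqL, hqT⟩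
    obtain ⟨y, hy, rfl⟩ := AddSubgroup.mem_map.1 hqL
    have hysel : y ∈ (inv.dualSelmerStructure ρ 𝓕).selmerGroup := by
      rw [SelmerStructure.mem_selmerGroup_iff]
      intro v
      by_cases hv : v ∈ S
      · have h1 := (AddSubgroup.mem_pi _).1 hqT ⟨v, hv⟩ (Set.mem_univ _)
        rwa [AddMonoidHom.pi_apply] at h1
      · rcases v with w | v'
        · exact absurd (h𝓕.1 w) hv
        · rw [(hUO.isUnramifiedOutside_dualSelmerStructure ρ hM hS h𝓕).2 v' hv]
          exact (memHSD y).1 hy v' hv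
    have h0 := horth y hysel
    rw [← Finset.sum_coe_sort S] at h0
    rw [hb]
    exact h0
  -- decompose: `{}^⊥(LD ⊓ T') = {}^⊥LD ⊔ T ≤ L ⊔ T`
  rw [annLeft_inf hAn hBn b hbij hbijflip, hT'T] at htS
  obtain ⟨l, hl, τ, hτ, hlτ⟩ := AddSubgroup.mem_sup.1 htS
  obtain ⟨x, hx, rfl⟩ := AddSubgroup.mem_map.1 (hD hl)
  have hcomp : ∀ i : ↥S, galoisCohomology.localization ρ (i : Place K) 1 x + τ i = t i := fun i => by
    have h1 := congr_fun hlτ i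
    rwa [Pi.add_apply, AddMonoidHom.pi_apply] at h1
  have hτ' : ∀ i : ↥S, τ i ∈ 𝓕 (i : Place K) := fun i =>
    (AddSubgroup.mem_pi _).1 hτ i (Set.mem_univ _)
  refine ⟨x, ?_, fun v hv => ?_⟩
  · rw [SelmerStructure.mem_selmerGroup_iff]
    intro v
    by_cases hv : v ∈ S
    · have h2 : galoisCohomology.localization ρ v 1 x = t v - τ ⟨v, hv⟩ := by
        rw [← hcomp ⟨v, hv⟩, add_sub_cancel_right]
      rw [h2]
      exact sub_mem (ht v hv) (hle v (hτ' ⟨v, hv⟩))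
    · rcases v with w | v'
      · exact absurd (h𝓖.1 w) hv
      · rw [h𝓖.2 v' hv]
        exact (memHS x).1 hx v' hv
  · have h2 : galoisCohomology.localization ρ v 1 x - t v = -τ ⟨v, hv⟩ := by
      rw [← hcomp ⟨v, hv⟩]; abel
    rw [h2]
    exact neg_mem (hτ' ⟨v, hv⟩)

/-- **Howard Thm. 2.1.11, second exact sequence, inclusion `⊇`, for `𝓕 ≤ 𝓖` unramified outside
`S`, FROM the basic middle exactness for the dual module** (hypothesis `hE'`: a family
`(u_v)_{v ∈ S}`, `u_v ∈ H¹(K_v, M^D)`, with `∑_{v∈S} ⟨x_v, u_v⟩_v = 0` for every global `x ∈ H¹(K, M)`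
unramified outside `S` is the localisation of a global `y ∈ H¹(K, M^D)` unramified outside `S` —
Milne I Thm. 4.10(b) for `M^D`, read through `M^{DD} = M`).  Mechanism: the right annihilator of
`loc(H¹_𝓖(K, M)) ⊇ loc(H¹_S(K, M)) ⊓ ⊕_v 𝓖_v` is contained in `loc(H¹_S(K, M^D))^{…} ⊔ ⊕_v 𝓖_v^*`.
[cite: Howard2004HeegnerKolyvagin, Thm. 2.1.11 (arXiv:1202.6340 p. 6)] [cite: MilneADT2006, Ch. I, Thm. 4.10(b)] -/
theorem exists_dualSelmer_sub_mem_of_middleExact (inv : LocalInvariants K n) (hperf : inv.IsPerfect)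
    (hreal : inv.InjectiveAtRealPlaces) (hUO : inv.UnramifiedOrthogonal)
    (ρ : DiscreteGaloisModule K M) (hM : ∀ m : M, n • m = 0) {S : Finset (Place K)}
    (hS : ∀ v : HeightOneSpectrum (𝓞 K), (Sum.inr v : Place K) ∉ S →
      ((n : ℕ) : 𝓞 K) ∉ v.asIdeal ∧ GaloisRep.IsUnramifiedAt v ρ)
    (hE' : ∀ u : Π v : Place K, galoisCohomology ((ρ.tateDual n).toLocal v) 1,
      (∀ x : galoisCohomology ρ 1,
        (∀ v : HeightOneSpectrum (𝓞 K), (Sum.inr v : Place K) ∉ S →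
          galoisCohomology.localization ρ (Sum.inr v) 1 x ∈
            unramifiedSubgroup (GaloisRep.toLocal v ρ) 1) →
        ∑ v ∈ S, localTatePairingZMod ρ n v (inv v)
          (galoisCohomology.localization ρ v 1 x) (u v) = 0) →
      ∃ y : galoisCohomology (ρ.tateDual n) 1,
        (∀ v : HeightOneSpectrum (𝓞 K), (Sum.inr v : Place K) ∉ S →
          galoisCohomology.localization (ρ.tateDual n) (Sum.inr v) 1 y ∈
            unramifiedSubgroup (GaloisRep.toLocal v (ρ.tateDual n)) 1) ∧
        ∀ v ∈ S, galoisCohomology.localization (ρ.tateDual n) v 1 y = u v)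
    {𝓕 𝓖 : SelmerStructure ρ} (hle : 𝓕 ≤ 𝓖) (h𝓕 : 𝓕.IsUnramifiedOutside S)
    (h𝓖 : 𝓖.IsUnramifiedOutside S)
    (u : Π v : Place K, galoisCohomology ((ρ.tateDual n).toLocal v) 1)
    (hu : ∀ v ∈ S, u v ∈ inv.dualSelmerStructure ρ 𝓕 v)
    (horth : ∀ x ∈ 𝓖.selmerGroup,
      ∑ v ∈ S, localTatePairingZMod ρ n v (inv v)
        (galoisCohomology.localization ρ v 1 x) (u v) = 0) :
    ∃ y ∈ (inv.dualSelmerStructure ρ 𝓕).selmerGroup,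
      ∀ v ∈ S, galoisCohomology.localization (ρ.tateDual n) v 1 y - u v ∈
        inv.dualSelmerStructure ρ 𝓖 v := by
  classical
  haveI : ∀ i : ↥S, Finite (galoisCohomology (ρ.toLocal (i : Place K)) 1) := fun i =>
    finite_galoisCohomology_one_toLocal_place ρ i
  haveI : ∀ i : ↥S, Finite (galoisCohomology ((ρ.tateDual n).toLocal (i : Place K)) 1) := fun i =>
    finite_galoisCohomology_one_tateDual_toLocal_place ρ i
  have hAn : ∀ p : Π i : ↥S, galoisCohomology (ρ.toLocal (i : Place K)) 1, n • p = 0 :=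
    pi_nsmul_eq_zero fun i x => galoisCohomology.nsmul_eq_zero_of_forall _ hM x
  have hBn : ∀ q : Π i : ↥S, galoisCohomology ((ρ.tateDual n).toLocal (i : Place K)) 1, n • q = 0 :=
    pi_nsmul_eq_zero fun i y => galoisCohomology.nsmul_eq_zero_of_forall _
      (fun f => DiscreteGaloisModule.TateDual.nsmul_eq_zero f) y
  obtain ⟨b, hb⟩ := exists_piPairing
    (fun i : ↥S => localTatePairingZMod ρ n (i : Place K) (inv (i : Place K)))
  have hloc := fun i : ↥S => bijective_localTatePairingZMod_place inv hperf hreal ρ hM (i : Place K)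
  obtain ⟨hbij, hbijflip⟩ := AddMonoidHom.bijective_of_injective_of_injective_flip hAn hBn b
    (piPairing_injective hb fun i => (hloc i).1.1) (piPairing_flip_injective hb fun i => (hloc i).2.1)
  let locS : galoisCohomology ρ 1 →+ Π i : ↥S, galoisCohomology (ρ.toLocal (i : Place K)) 1 :=
    AddMonoidHom.pi fun i : ↥S => galoisCohomology.localization ρ (i : Place K) 1
  let locSD : galoisCohomology (ρ.tateDual n) 1 →+
      Π i : ↥S, galoisCohomology ((ρ.tateDual n).toLocal (i : Place K)) 1 :=
    AddMonoidHom.pi fun i : ↥S => galoisCohomology.localization (ρ.tateDual n) (i : Place K) 1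
  let HS : AddSubgroup (galoisCohomology ρ 1) :=
    ⨅ (v : HeightOneSpectrum (𝓞 K)) (_ : (Sum.inr v : Place K) ∉ S),
      (unramifiedSubgroup (GaloisRep.toLocal v ρ) 1).comap
        (galoisCohomology.localization ρ (Sum.inr v) 1)
  let HSD : AddSubgroup (galoisCohomology (ρ.tateDual n) 1) :=
    ⨅ (v : HeightOneSpectrum (𝓞 K)) (_ : (Sum.inr v : Place K) ∉ S),
      (unramifiedSubgroup (GaloisRep.toLocal v (ρ.tateDual n)) 1).comap
        (galoisCohomology.localization (ρ.tateDual n) (Sum.inr v) 1)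
  have memHS : ∀ x, x ∈ HS ↔ ∀ v : HeightOneSpectrum (𝓞 K), (Sum.inr v : Place K) ∉ S →
      galoisCohomology.localization ρ (Sum.inr v) 1 x ∈ unramifiedSubgroup (GaloisRep.toLocal v ρ) 1 :=
    fun x => by simp only [HS, AddSubgroup.mem_iInf, AddSubgroup.mem_comap]; exact Iff.rfl
  have memHSD : ∀ y, y ∈ HSD ↔ ∀ v : HeightOneSpectrum (𝓞 K), (Sum.inr v : Place K) ∉ S →
      galoisCohomology.localization (ρ.tateDual n) (Sum.inr v) 1 y ∈
        unramifiedSubgroup (GaloisRep.toLocal v (ρ.tateDual n)) 1 :=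
    fun y => by simp only [HSD, AddSubgroup.mem_iInf, AddSubgroup.mem_comap]; exact Iff.rfl
  -- the local conditions `𝓖_v` on `S` and their duals
  let G : AddSubgroup (Π i : ↥S, galoisCohomology (ρ.toLocal (i : Place K)) 1) :=
    AddSubgroup.pi Set.univ fun i => 𝓖 (i : Place K)
  let U : AddSubgroup (Π i : ↥S, galoisCohomology ((ρ.tateDual n).toLocal (i : Place K)) 1) :=
    AddSubgroup.pi Set.univ fun i => inv.dualSelmerStructure ρ 𝓖 (i : Place K)
  have hGU : annRight b G = U := by
    rw [annRight_pi hb]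
    rfl
  -- (D') the dual basic exactness: `loc(H¹_S(M))^⊥ ≤ loc(H¹_S(M^D))`
  have hD : annRight b (HS.map locS) ≤ HSD.map locSD := by
    intro q hq
    let u₀ : Π v : Place K, galoisCohomology ((ρ.tateDual n).toLocal v) 1 := fun v =>
      if h : v ∈ S then q ⟨v, h⟩ else 0
    have hu₀ : ∀ i : ↥S, u₀ i = q i := fun i => by
      simp only [u₀, dif_pos i.2]
    obtain ⟨y, hyur, hyS⟩ := hE' u₀ fun x hx => by
      have hp : locS x ∈ HS.map locS := AddSubgroup.mem_map_of_mem _ ((memHS x).2 hx)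
      have h0 := hq _ hp
      rw [hb] at h0
      rw [← Finset.sum_coe_sort]
      refine Eq.trans (Finset.sum_congr rfl fun i _ => ?_) h0
      rw [hu₀ i]
      rfl
    refine ⟨y, (memHSD y).2 hyur, funext fun i => ?_⟩
    rw [AddMonoidHom.pi_apply, hyS i i.2, hu₀ i]
  -- `u|_S` is annihilated by `loc(H¹_S(M)) ⊓ ⊕ 𝓖_v ⊆ loc(H¹_𝓖(K, M))`
  have huS : (fun i : ↥S => u i) ∈ annRight b (HS.map locS ⊓ G) := by
    rw [mem_annRight_iff]
    rintro p ⟨hpL, hpG⟩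
    obtain ⟨x, hx, rfl⟩ := AddSubgroup.mem_map.1 hpL
    have hxsel : x ∈ 𝓖.selmerGroup := by
      rw [SelmerStructure.mem_selmerGroup_iff]
      intro v
      by_cases hv : v ∈ S
      · have h1 := (AddSubgroup.mem_pi _).1 hpG ⟨v, hv⟩ (Set.mem_univ _)
        rwa [AddMonoidHom.pi_apply] at h1
      · rcases v with w | v'
        · exact absurd (h𝓖.1 w) hv
        · rw [h𝓖.2 v' hv]
          exact (memHS x).1 hx v' hv
    have h0 := horth x hxsel
    rw [← Finset.sum_coe_sort S] at h0
    rw [hb]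
    exact h0
  -- decompose: `(L ⊓ G)^⊥ = L^⊥ ⊔ U ≤ LD ⊔ U`
  rw [annRight_inf hAn hBn b hbij hbijflip, hGU] at huS
  obtain ⟨l, hl, μ, hμ, hlμ⟩ := AddSubgroup.mem_sup.1 huS
  obtain ⟨y, hy, rfl⟩ := AddSubgroup.mem_map.1 (hD hl)
  have hcomp : ∀ i : ↥S,
      galoisCohomology.localization (ρ.tateDual n) (i : Place K) 1 y + μ i = u i := fun i => by
    have h1 := congr_fun hlμ i
    rwa [Pi.add_apply, AddMonoidHom.pi_apply] at h1
  have hμ' : ∀ i : ↥S, μ i ∈ inv.dualSelmerStructure ρ 𝓖 (i : Place K) := fun i =>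
    (AddSubgroup.mem_pi _).1 hμ i (Set.mem_univ _)
  refine ⟨y, ?_, fun v hv => ?_⟩
  · rw [SelmerStructure.mem_selmerGroup_iff]
    intro v
    by_cases hv : v ∈ S
    · have h2 : galoisCohomology.localization (ρ.tateDual n) v 1 y = u v - μ ⟨v, hv⟩ := by
        rw [← hcomp ⟨v, hv⟩, add_sub_cancel_right]
      rw [h2]
      exact sub_mem (hu v hv) (inv.dualSelmerStructure_anti ρ hle v (hμ' ⟨v, hv⟩))
    · rcases v with w | v'
      · exact absurd (h𝓕.1 w) hv
      · rw [(hUO.isUnramifiedOutside_dualSelmerStructure ρ hM hS h𝓕).2 v' hv]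
        exact (memHSD y).1 hy v' hv
  · have h2 : galoisCohomology.localization (ρ.tateDual n) v 1 y - u v = -μ ⟨v, hv⟩ := by
      rw [← hcomp ⟨v, hv⟩]; abel
    rw [h2]
    exact neg_mem (hμ' ⟨v, hv⟩)

end Reduction

end Summit.BirchSwinnertonDyer.BirchSwinnertonDyer.Theorems.SchneiderFreeAdditiveX3.PoitouTateReduction

end
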